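import Summits.BirchSwinnertonDyer.BirchSwinnertonDyer.Theorems.ManinLocalTwoThreeKummerCoverNotGammaOne
import Summits.BirchSwinnertonDyer.Rank1Residual.ManinAdditive.UDCKummerLine
import HarnessLib

/-!
# C3 v21 stub (NC-b)@9 `stub_kummerCoverNotGammaOneAtNine` CLOSED, by name
# (route `ManinLocalTwoThree`, crux C3 `ManinPrimeToThreeAtNine` stmt-BirchSwinnertonDyer-22968; cell bsd-f2-manin, prover seat p3 gen 15;
# skeleton `Lines/kato_shift_three.lean` v21 of the C3 LEAD p1 g15, HOME/p1/g15/Line-kato-shift-three-v21.lean)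

The LEAD's v21 stub 3 is -an's (NC-b) `UDCKummerLine.KummerCoverNotGammaOne` with the extra binder `9 ∣ N` after the lattice clause and
`℘`, `℘'` spelled `D.L.weierstrassP`, `D.L.derivWeierstrassP`; its conclusion `¬ KummerPeriodTrivial D u γ` unfolds to the conclusion of this
seat's `KummerCover.exists_mem_gamma1_not_kummerPeriodTrivial` (`Theorems/ManinLocalTwoThreeKummerCoverNotGammaOne.lean`, p725597), which
needs neither `u ∉ Λ_E` nor the `℘'` clause.  So the stub is a THEOREM with LITERALLY the registered signature.  HONEST FRAMING: one stub of a
CONDITIONAL reduction (F₃♮ printed Kato, UDC + Kurth–Long printed, AN♮ and RES₃♭ open); C3, Manin's conjecture and BSD are NOT proved.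
-/

set_option autoImplicit false
-- lint-debt: the directory name repeats the summit name (sibling precedent `ManinLocalTwoThreeKummerCoverNotGammaOne.lean`)
set_option linter.dupNamespace false

noncomputable section

open scoped MatrixGroups
open CongruenceSubgroup WeierstrassCurve Literature.NumberTheory.EllipticCurves Literature.NumberTheory.EllipticCurves.ModularForms
open Summit.BirchSwinnertonDyer.Rank1Residual.ManinAdditive
open Summit.BirchSwinnertonDyer.Rank1Residual.ManinAdditive.CuspidalKummerThree

namespace Summit.BirchSwinnertonDyer.BirchSwinnertonDyer.Theorems

/-- **Stub (NC-b)@9 of `kato_shift_three` v21, BY NAME and with the registered signature**: for a lattice-optimal `X₀(N)`-datum, `9 ∣ N`,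
a rational short `3`-torsion point with analytic lift `u`, some `γ ∈ Γ₁(N)` has `¬ KummerPeriodTrivial D u γ` (the Kummer cover `Y_T`
is not a quotient of `X₁(N)`).  Proof: `ManinLocalTwoThree.KummerCover.exists_mem_gamma1_not_kummerPeriodTrivial` (the LEAD's μ₃-type
theorem `no_rational_kernel_generator` + `𝔽₃`-linear algebra).  Nothing about C3 or BSD is proved by this.
[cite: Stevens1989, §2 Thm. 2.3 (shape: the Shimura kernel)] -/
theorem stub_kummerCoverNotGammaOneAtNine :
    ∀ (W : WeierstrassCurve ℚ) [W.IsElliptic] [W.IsGloballyMinimal] {N : ℕ} [NeZero N]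
      (D : ModularParametrizationData W N),
      (∀ z ∈ D.L.lattice, ∃ w ∈ periodLattice D.f, z = D.c * w) → 9 ∣ N →
      ∀ X₀ Y₀ : ℚ, IsShortThreeTorsion W D.c X₀ Y₀ →
      ∀ u : ℂ, u ∉ D.L.lattice → 3 * u ∈ D.L.lattice →
      (D.c : ℂ) ^ 2 * D.L.weierstrassP u = (X₀ : ℂ) → (D.c : ℂ) ^ 3 * D.L.derivWeierstrassP u / 2 = (Y₀ : ℂ) →
      ∃ γ : Gamma0 N, (γ : SL(2, ℤ)) ∈ Gamma1 N ∧ ¬ UDCKummerLine.KummerPeriodTrivial D u γ :=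
  fun W _ _ _ _ D hopt h9 X₀ Y₀ hT u _ h3u hX _ ↦
    ManinLocalTwoThree.KummerCover.exists_mem_gamma1_not_kummerPeriodTrivial W D h9 hopt X₀ Y₀ hT u h3u hX

end Summit.BirchSwinnertonDyer.BirchSwinnertonDyer.Theorems

end
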